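import Literature.InformationTheory.QuantumCodes.GraphlikeSyndromes
import Literature.Barriers.PneNP.TSPExtensionComplexityMatchings
import HarnessLib

/-!
# Perfect matchings of the syndrome defects: link metrics, matching costs, and the Korte–Vygen lemma
# «some perfect matching of ∂e costs at most |e|»

Topic `Literature/InformationTheory/QuantumCodes` (venture QEC, LADDER-QEC Q5 «toric/surface + MWPM»; qec-type-09
gen 4). Second of three files (`GraphlikeSyndromes` → `MatchingCost` → `MatchingDecoders`). Perfect matchings
are the tree's `IsPMOn S M` / `perfectMatchings S` (Literature/Barriers/PneNP/TSPExtensionComplexityMatchings: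
edge sets `M : Finset (Sym2 V)` covering every vertex of `S` exactly once), reused by import. Contents
(all PROVED, 0 facts, kernel axioms):

* `EdgeMetric ι` — a symmetric `ℕ`-valued weight `d` on pairs of sites with the triangle inequality and
  `d ≤ 1` across every link of the graphlike model `ι` (unit link weights; the metric closure `c̄` of
  Korte–Vygen's proof of Thm 12.9; canonical instance `chainMetric` = shortest chains); `m.pairCost`,
  **`m.cost M = Σ_{s(a,b) ∈ M} d a b`**, **`m.IsMinCostMatching S M`**;
* perfect-matching surgery: `IsPMOn.exists_partner`, `erase_pair`, `insert_pair`, `eq_singleton_of_pair`,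
  and **`EdgeMetric.exists_isPMOn_symmDiff`** — toggling the two ends of a proper pair `{a, b}` in the
  vertex set changes the optimal matching cost by at most `d a b` (four cases, triangle inequality);
* **`EdgeMetric.exists_isPMOn_cost_le`** — for every chain `e` the defect set `supp ∂e` has a perfect
  matching of cost `≤ |e|`: the matching half of Korte–Vygen Lemma 12.8 / proof of Thm 12.9 ("By Lemma
  12.8, `c̄(M)` is at most the minimum weight of a `T`-join"); our proof peels the links of `e` one at a
  time instead of decomposing an optimum `T`-join into paths;
* `EdgeMetric.d_le_hammingNorm` (a chain joining `a ≠ b` has `≥ d a b` links), `chainMetric`,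
  `EdgeMetric.d_le_chainDist` (every link metric is dominated by the shortest-chain metric).
-- TODO(general form): Korte–Vygen allow nonnegative REAL link weights `c : E → ℝ₊` (DKLP's anisotropic
-- `p ≠ q` weights); here every link weighs `1` (`hammingNorm`), as the tree's threshold theorems require.

## References
* [KorteVygen2002] B. Korte, J. Vygen, *Combinatorial Optimization. Theory and Algorithms*, 2nd ed.,
  Springer (2002), §12.2 "T-joins", Def 12.5, Prop 12.6, Lemma 12.8 and Theorem 12.9 (Edmonds–Johnson),
  pp. 275–277.
* [EdmondsJohnson1973] J. Edmonds, E. L. Johnson, *Matching, Euler tours and the Chinese postman*,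
  Math. Programming 5 (1973) 88–124 (the source of Thm 12.9; cited through Korte–Vygen).
* [DennisEtAl2002] E. Dennis, A. Kitaev, A. Landahl, J. Preskill, *Topological quantum memory*, J. Math.
  Phys. 43 (2002) 4452–4505, arXiv:quant-ph/0110143, §4.4 (p. 18) and §5.1 (p. 19).
-/

namespace Literature.InformationTheory.QuantumCodes

open Finset Matrix Literature.Barriers.PneNP
open scoped symmDiff

variable {V E : Type*}

/-! ### Link metrics and matching costs -/

/-- A **link metric** for the fault model `ι`: a symmetric `ℕ`-valued weight on pairs of sites obeying the
triangle inequality and at most `1` across every link (the weights `c̄` of the metric closure, unit link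
weights). (definition) [cite: KorteVygen2002, §12.2 proof of Thm 12.9 (metric closure (Ḡ, c̄))] -/
structure EdgeMetric (ι : E → Sym2 V) where
  /-- the distance -/
  d : V → V → ℕ
  /-- symmetry -/
  symm : ∀ u v, d u v = d v u
  /-- triangle inequality -/
  triangle : ∀ u v w, d u w ≤ d u v + d v w
  /-- every link has length at most one -/
  ends_le_one : ∀ ℓ a b, ι ℓ = s(a, b) → d a b ≤ 1

namespace EdgeMetric

variable {ι : E → Sym2 V} (m : EdgeMetric ι)

/-- The weight of a pair, `s(a, b) ↦ d a b` (well defined by symmetry).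
[cite: KorteVygen2002, §12.2 proof of Thm 12.9 (c̄({x,y}))] -/
def pairCost : Sym2 V → ℕ :=
  Sym2.lift ⟨m.d, m.symm⟩

/-- `pairCost s(a, b) = d a b`. [cite: KorteVygen2002, §12.2 proof of Thm 12.9 (c̄({x, y}))] -/
@[simp] theorem pairCost_mk (a b : V) : m.pairCost s(a, b) = m.d a b := rfl

/-- The **cost of a set of pairs** (of a matching): `c̄(M) = Σ_{{x,y} ∈ M} d x y`.
[cite: KorteVygen2002, §12.2 proof of Thm 12.9 (c̄(M))] -/
def cost (M : Finset (Sym2 V)) : ℕ :=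
  ∑ p ∈ M, m.pairCost p

/-- A **minimum-cost perfect matching** of the vertex set `S` for the weights `d`. (definition)
[cite: KorteVygen2002, §12.2 proof of Thm 12.9 (minimum weight perfect matching M in (Ḡ[T], c̄))] -/
def IsMinCostMatching [DecidableEq V] (S : Finset V) (M : Finset (Sym2 V)) : Prop :=
  IsPMOn S M ∧ ∀ M', IsPMOn S M' → m.cost M ≤ m.cost M'

/-- A vertex set with a perfect matching has a minimum-cost one (finitely many candidates). [cite: KorteVygen2002, §12.2 proof of Thm 12.9 ("we find a minimum weight perfect matching M")] -/
theorem exists_isMinCostMatching [DecidableEq V] {S : Finset V} (h : ∃ M, IsPMOn S M) :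
    ∃ M, m.IsMinCostMatching S M := by
  obtain ⟨M₀, hM₀⟩ := h
  obtain ⟨M, hM, hmin⟩ := exists_min_image (perfectMatchings S) m.cost ⟨M₀, mem_perfectMatchings.2 hM₀⟩
  exact ⟨M, mem_perfectMatchings.1 hM, fun M' hM' => hmin M' (mem_perfectMatchings.2 hM')⟩

/-- The empty set is cost-free. [cite: KorteVygen2002, §12.2 Lemma 12.8 proof (T = ∅: minimum weight zero)] -/
@[simp] theorem cost_empty : m.cost ∅ = 0 := by
  simp [cost]

/-- Cost of a matching with one pair removed. [cite: KorteVygen2002, §12.2 proof of Thm 12.9 (c̄(M) = Σ c̄({x,y}))] -/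
theorem cost_erase_add [DecidableEq V] {M : Finset (Sym2 V)} {p : Sym2 V} (hp : p ∈ M) :
    m.cost (M.erase p) + m.pairCost p = m.cost M := by
  unfold cost
  rw [sum_erase_add _ _ hp]

/-- Cost of a matching with one new pair added. [cite: KorteVygen2002, §12.2 proof of Thm 12.9 (c̄(M) = Σ c̄({x,y}))] -/
theorem cost_insert [DecidableEq V] {M : Finset (Sym2 V)} {p : Sym2 V} (hp : p ∉ M) :
    m.cost (insert p M) = m.cost M + m.pairCost p := by
  unfold cost
  rw [sum_insert hp, add_comm]

end EdgeMetric

/-! ### Perfect matchings: partners, removing a pair -/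

section Matchings

variable [DecidableEq V]

/-- The **partner** of a matched vertex: some `x ≠ a` in `S` with `s(a, x) ∈ M`. [cite: KorteVygen2002, §12.2 proof of Thm 12.9 (each {x, y} ∈ M)] -/
theorem _root_.Literature.Barriers.PneNP.IsPMOn.exists_partner {S : Finset V} {M : Finset (Sym2 V)} (hM : IsPMOn S M) {a : V}
    (ha : a ∈ S) : ∃ x, x ≠ a ∧ x ∈ S ∧ s(a, x) ∈ M := by
  obtain ⟨p, hp, hap⟩ := hM.exists_mem ha
  refine ⟨Sym2.Mem.other hap, Sym2.other_ne (hM.not_isDiag hp) hap,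
    hM.mem_of_mem hp (Sym2.other_mem hap), ?_⟩
  rw [Sym2.other_spec hap]
  exact hp

/-- No pair of the matching contains a vertex outside `S`. [cite: KorteVygen2002, §12.2 proof of Thm 12.9 (M is a perfect matching of Ḡ[T])] -/
theorem _root_.Literature.Barriers.PneNP.IsPMOn.mk_not_mem {S : Finset V} {M : Finset (Sym2 V)} (hM : IsPMOn S M) {a x : V}
    (ha : a ∉ S) : s(a, x) ∉ M :=
  fun h => ha (hM.mem_of_mem h (Sym2.mem_mk_left a x))

/-- **Removing a pair**: if `s(a, b) ∈ M` then `M.erase s(a, b)` is a perfect matching of `S \ {a, b}`.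
[cite: KorteVygen2002, §12.2 Lemma 12.8 proof (J ∖ E(P) matches T ∖ {x, y})] -/
theorem _root_.Literature.Barriers.PneNP.IsPMOn.erase_pair {S : Finset V} {M : Finset (Sym2 V)} (hM : IsPMOn S M) {a b : V}
    (hab : s(a, b) ∈ M) : IsPMOn (S \ {a, b}) (M.erase s(a, b)) := by
  have hne : a ≠ b := fun h => hM.not_isDiag hab (by rw [Sym2.mk_isDiag_iff]; exact h)
  have hsub : ({a, b} : Finset V) ⊆ S := by
    intro v hv
    rw [mem_insert, mem_singleton] at hv
    rcases hv with rfl | rfl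
    · exact hM.mem_of_mem hab (Sym2.mem_mk_left _ _)
    · exact hM.mem_of_mem hab (Sym2.mem_mk_right _ _)
  have hS : ({a, b} : Finset V) ∪ (S \ {a, b}) = S := union_sdiff_of_subset hsub
  have h' : IsPMOn ({a, b} ∪ (S \ {a, b})) M := by rw [hS]; exact hM
  have := h'.sdiff disjoint_sdiff (IsPMOn.pair hne) (singleton_subset_iff.2 hab)
  rwa [sdiff_singleton_eq_erase] at this

/-- **Re-attaching a pair**: a perfect matching of `S` plus a fresh proper pair `{a, b}` disjoint from
`S` is a perfect matching of `S ∪ {a, b}`. [cite: KorteVygen2002, §12.2 Prop 12.6 proof (T partitioned into pairs {v_i, w_i})] -/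
theorem _root_.Literature.Barriers.PneNP.IsPMOn.insert_pair {S : Finset V} {M : Finset (Sym2 V)} (hM : IsPMOn S M) {a b : V}
    (hab : a ≠ b) (ha : a ∉ S) (hb : b ∉ S) : IsPMOn (S ∪ {a, b}) (insert s(a, b) M) := by
  have hd : Disjoint S {a, b} := by
    rw [disjoint_insert_right, disjoint_singleton_right]
    exact ⟨ha, hb⟩
  have := hM.union (IsPMOn.pair hab) hd
  rwa [union_comm M, ← insert_eq] at this

/-- The only perfect matching of a proper pair `{a, b}` is `{s(a, b)}`. [cite: KorteVygen2002, §12.2 (|T| = 2, say T = {s, t})] -/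
theorem _root_.Literature.Barriers.PneNP.IsPMOn.eq_singleton_of_pair {a b : V} (hab : a ≠ b) {M : Finset (Sym2 V)}
    (hM : IsPMOn ({a, b} : Finset V) M) : M = {s(a, b)} := by
  obtain ⟨x, hxa, hx, hax⟩ := hM.exists_partner (a := a) (by simp)
  have hxb : x = b := by
    rw [mem_insert, mem_singleton] at hx
    rcases hx with h | h
    · exact absurd h hxa
    · exact h
  subst hxb
  ext p
  rw [mem_singleton]
  constructor
  · intro hp
    induction p using Sym2.ind with
    | h u v =>
      have hu := hM.mem_of_mem hp (Sym2.mem_mk_left u v)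
      have hv := hM.mem_of_mem hp (Sym2.mem_mk_right u v)
      have huv : u ≠ v := fun h => hM.not_isDiag hp (by rw [Sym2.mk_isDiag_iff]; exact h)
      rw [mem_insert, mem_singleton] at hu hv
      rcases hu with rfl | rfl <;> rcases hv with rfl | rfl
      · exact absurd rfl huv
      · rfl
      · exact Sym2.eq_swap
      · exact absurd rfl huv
  · rintro rfl
    exact hax

end Matchings

/-! ### Matching surgery under toggling the two ends of a link -/

namespace EdgeMetric

variable [DecidableEq V] {ι : E → Sym2 V} (m : EdgeMetric ι)

/-- Surgery, case "`a` matched, `b` free": re-attach `a`'s partner to `b`.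
[cite: KorteVygen2002, §12.2 Lemma 12.8 (proof idea: J \ E(P) is a (T \ {x,y})-join)] -/
theorem exists_isPMOn_symmDiff_of_mem_of_not_mem {S : Finset V} {M : Finset (Sym2 V)} (hM : IsPMOn S M)
    {a b : V} (ha : a ∈ S) (hb : b ∉ S) :
    ∃ M', IsPMOn (S ∆ {a, b}) M' ∧ m.cost M' ≤ m.cost M + m.d a b := by
  obtain ⟨x, hxa, hxS, hax⟩ := hM.exists_partner ha
  have hxb : x ≠ b := fun h => hb (h ▸ hxS)
  have h1 : IsPMOn (S \ {a, x}) (M.erase s(a, x)) := hM.erase_pair hax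
  have h2 : IsPMOn (S \ {a, x} ∪ {b, x}) (insert s(b, x) (M.erase s(a, x))) :=
    h1.insert_pair hxb.symm (fun h => hb (mem_sdiff.1 h).1) (fun h => by simp at h)
  have hS : S \ {a, x} ∪ {b, x} = S ∆ {a, b} := by
    ext v
    simp only [mem_union, mem_sdiff, mem_insert, mem_singleton, mem_symmDiff]
    by_cases hva : v = a
    · subst hva
      have hvb : v ≠ b := fun h => hb (h ▸ ha)
      simp [hxa.symm, hvb, ha]
    · by_cases hvb : v = b
      · subst hvb; simp [hva, hb]
      · by_cases hvx : v = x
        · subst hvx; simp [hxS, hva, hvb]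
        · simp [hva, hvb, hvx]
  refine ⟨insert s(b, x) (M.erase s(a, x)), hS ▸ h2, ?_⟩
  have hbx : s(b, x) ∉ M.erase s(a, x) := fun h => hM.mk_not_mem hb (mem_of_mem_erase h)
  rw [m.cost_insert hbx, ← m.cost_erase_add hax, pairCost_mk, pairCost_mk, add_assoc]
  refine Nat.add_le_add_left ?_ _
  calc m.d b x ≤ m.d b a + m.d a x := m.triangle b a x
    _ = m.d a x + m.d a b := by rw [m.symm b a, add_comm]

/-- **Matching surgery.** If `M` is a perfect matching of `S` and `{a, b}` is a proper pair, the toggled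
set `S ∆ {a, b}` has a perfect matching of cost at most `cost M + d a b` (cases: both ends matched to
each other / to third vertices `x, y` — rematch `x` with `y`; one end matched — move its pair to the other
end; no end matched — add the pair `{a, b}`; each time by the triangle inequality).
[cite: KorteVygen2002, §12.2 Lemma 12.8 (proof: J \ E(P) is a minimum cost (T \ {x, y})-join)] -/
theorem exists_isPMOn_symmDiff {S : Finset V} {M : Finset (Sym2 V)} (hM : IsPMOn S M) {a b : V}
    (hab : a ≠ b) : ∃ M', IsPMOn (S ∆ {a, b}) M' ∧ m.cost M' ≤ m.cost M + m.d a b := by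
  by_cases ha : a ∈ S <;> by_cases hb : b ∈ S
  · -- both ends are defects: `S ∆ {a,b} = S \ {a,b}`
    have hS : S ∆ {a, b} = S \ {a, b} := by
      ext v
      simp only [mem_symmDiff, mem_sdiff, mem_insert, mem_singleton]
      constructor
      · rintro (h | ⟨h1, h2⟩)
        · exact h
        · rcases h1 with rfl | rfl
          · exact absurd ha h2
          · exact absurd hb h2
      · exact fun h => Or.inl h
    rw [hS]
    by_cases hp : s(a, b) ∈ M
    · refine ⟨M.erase s(a, b), hM.erase_pair hp, ?_⟩
      rw [← m.cost_erase_add hp]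
      exact (Nat.le_add_right _ _).trans (Nat.le_add_right _ _)
    · obtain ⟨x, hxa, hxS, hax⟩ := hM.exists_partner ha
      obtain ⟨y, hyb, hyS, hby⟩ := hM.exists_partner hb
      have hxb : x ≠ b := fun h => hp (h ▸ hax)
      have hya : y ≠ a := fun h => hp (by rw [Sym2.eq_swap]; exact h ▸ hby)
      have hxy : x ≠ y := by
        intro h
        subst h
        have := hM.unique hax hby (Sym2.mem_mk_right a x) (Sym2.mem_mk_right b x)
        rw [Sym2.eq_iff] at this
        rcases this with ⟨h, -⟩ | ⟨h, -⟩
        · exact hab h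
        · exact hxa.symm h
      have h1 : IsPMOn (S \ {a, x}) (M.erase s(a, x)) := hM.erase_pair hax
      have hby' : s(b, y) ∈ M.erase s(a, x) := by
        rw [mem_erase]
        refine ⟨fun h => ?_, hby⟩
        rw [Sym2.eq_iff] at h
        rcases h with ⟨h, -⟩ | ⟨-, h⟩
        · exact hab h.symm
        · exact hya h
      have h2 : IsPMOn ((S \ {a, x}) \ {b, y}) ((M.erase s(a, x)).erase s(b, y)) := h1.erase_pair hby'
      have h3 : IsPMOn ((S \ {a, x}) \ {b, y} ∪ {x, y}) (insert s(x, y) ((M.erase s(a, x)).erase s(b, y))) :=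
        h2.insert_pair hxy (by simp) (by simp)
      have hS' : (S \ {a, x}) \ {b, y} ∪ {x, y} = S \ {a, b} := by
        ext v
        simp only [mem_union, mem_sdiff, mem_insert, mem_singleton]
        by_cases hva : v = a
        · subst hva; simp [hxa.symm, hya.symm]
        · by_cases hvb : v = b
          · subst hvb; simp [hxb.symm, hyb.symm]
          · by_cases hvx : v = x
            · subst hvx; simp [hxS, hva, hvb]
            · by_cases hvy : v = y
              · subst hvy; simp [hyS, hva, hvb]
              · simp [hva, hvb, hvx, hvy]
      refine ⟨_, hS' ▸ h3, ?_⟩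
      have hxy' : s(x, y) ∉ (M.erase s(a, x)).erase s(b, y) := by
        intro h
        have h' := mem_of_mem_erase (mem_of_mem_erase h)
        have := hM.unique hax h' (Sym2.mem_mk_right a x) (Sym2.mem_mk_left x y)
        rw [Sym2.eq_iff] at this
        rcases this with ⟨h, -⟩ | ⟨h, -⟩
        · exact hxa.symm h
        · exact hya h.symm
      rw [m.cost_insert hxy', ← m.cost_erase_add hax, ← m.cost_erase_add hby', pairCost_mk, pairCost_mk,
        pairCost_mk, add_assoc, add_assoc]
      refine Nat.add_le_add_left ?_ _
      calc m.d x y ≤ m.d x a + m.d a y := m.triangle x a y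
        _ ≤ m.d x a + (m.d a b + m.d b y) := Nat.add_le_add_left (m.triangle a b y) _
        _ = m.d b y + (m.d a x + m.d a b) := by rw [m.symm x a]; ring
  · exact m.exists_isPMOn_symmDiff_of_mem_of_not_mem hM ha hb
  · obtain ⟨M', h1, h2⟩ := m.exists_isPMOn_symmDiff_of_mem_of_not_mem hM hb ha
    refine ⟨M', by rwa [pair_comm], ?_⟩
    rwa [m.symm b a] at h2
  · -- no end is a defect: add the pair
    have hS : S ∆ {a, b} = S ∪ {a, b} := by
      ext v
      simp only [mem_symmDiff, mem_union, mem_insert, mem_singleton]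
      constructor
      · rintro (⟨h, -⟩ | ⟨h, -⟩)
        · exact Or.inl h
        · exact Or.inr h
      · rintro (h | h)
        · refine Or.inl ⟨h, ?_⟩
          rintro (rfl | rfl)
          · exact ha h
          · exact hb h
        · refine Or.inr ⟨h, ?_⟩
          rcases h with rfl | rfl
          · exact ha
          · exact hb
    rw [hS]
    refine ⟨insert s(a, b) M, hM.insert_pair hab ha hb, ?_⟩
    rw [m.cost_insert (hM.mk_not_mem ha), pairCost_mk]

/-! ### Korte–Vygen Lemma 12.8: a perfect matching of the defects of cost at most the chain weight -/

/-- **Every chain pays for a perfect matching of its boundary.** For every chain `e` (set of links) the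
defect set `supp ∂e` admits a perfect matching `M` with `c̄(M) ≤ |e|` — the matching half of "`c̄(M)` is at
most the minimum weight of a `T`-join" (our proof peels the links of `e` one at a time and applies the
surgery lemma; Korte–Vygen decompose an optimum `T`-join into paths).
[cite: KorteVygen2002, §12.2 Lemma 12.8 and proof of Thm 12.9 ("c̄(M) is at most the minimum weight of a T-join")] -/
theorem exists_isPMOn_cost_le [Fintype V] [Fintype E] [DecidableEq E] (e : E → ZMod 2) :
    ∃ M, IsPMOn (supp (graphSyn ι e)) M ∧ m.cost M ≤ hammingNorm e := by
  suffices h : ∀ (n : ℕ) (e : E → ZMod 2), hammingNorm e = n →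
      ∃ M, IsPMOn (supp (graphSyn ι e)) M ∧ m.cost M ≤ n from h _ e rfl
  intro n
  induction n with
  | zero =>
    intro e he
    rw [hammingNorm_eq_zero] at he
    subst he
    refine ⟨∅, ?_, by simp⟩
    rw [graphSyn_zero, supp_zero]
    exact IsPMOn.empty
  | succ k ih =>
    intro e he
    -- pick a link `ℓ` of `e` and peel it off
    have hne : (supp e).Nonempty := by
      rw [← card_pos]
      change 0 < hammingNorm e
      omega
    obtain ⟨ℓ, hℓ⟩ := hne
    rw [mem_supp_iff] at hℓ
    have h01 : ∀ y : ZMod 2, y = 0 ∨ y = 1 := by decide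
    have heℓ : e ℓ = 1 := (h01 (e ℓ)).resolve_left hℓ
    set e' : E → ZMod 2 := e + Pi.single ℓ 1 with he'
    have hsupp : supp e' = (supp e).erase ℓ := by
      ext j
      rw [mem_erase, mem_supp_iff, mem_supp_iff, he', Pi.add_apply]
      by_cases hj : j = ℓ
      · subst hj
        rw [heℓ, Pi.single_eq_same]
        have h2 : (1 : ZMod 2) + 1 = 0 := by decide
        simp [h2]
      · rw [Pi.single_eq_of_ne hj, add_zero]
        simp [hj]
    have hcard : hammingNorm e' = k := by
      change (supp e').card = k
      rw [hsupp, card_erase_of_mem (mem_supp_iff.2 hℓ)]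
      change hammingNorm e - 1 = k
      omega
    obtain ⟨M₀, hM₀, hc₀⟩ := ih e' hcard
    have hee : e = e' + Pi.single ℓ 1 := by rw [he', add_assoc, chain_add_self, add_zero]
    have hsyn : graphSyn ι e = graphSyn ι e' + pairIndicator (ι ℓ) := by
      rw [hee, graphSyn_add, graphSyn_single]
    obtain ⟨⟨a, b⟩, hq⟩ := Quot.exists_rep (ι ℓ)
    change s(a, b) = ι ℓ at hq
    by_cases hab : a = b
    · subst hab
      rw [← hq, pairIndicator_diag, add_zero] at hsyn
      rw [hsyn]
      exact ⟨M₀, hM₀, hc₀.trans (Nat.le_succ k)⟩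
    · rw [← hq] at hsyn
      obtain ⟨M, hM, hc⟩ := m.exists_isPMOn_symmDiff hM₀ hab
      refine ⟨M, ?_, ?_⟩
      · rwa [hsyn, supp_add_pairIndicator _ hab]
      · exact hc.trans (Nat.add_le_add hc₀ (m.ends_le_one ℓ a b hq.symm))

/-- **Every chain joining two distinct sites has at least `d` links**: if `∂γ = 1_a + 1_b` with `a ≠ b`
then `d a b ≤ |γ|`. [cite: KorteVygen2002, §12.2 (|T| = 2: T-joins and shortest paths)] -/
theorem d_le_hammingNorm [Fintype V] [Fintype E] [DecidableEq E] {a b : V} (hab : a ≠ b)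
    {γ : E → ZMod 2} (hγ : graphSyn ι γ = pairIndicator s(a, b)) : m.d a b ≤ hammingNorm γ := by
  obtain ⟨M, hM, hc⟩ := m.exists_isPMOn_cost_le γ
  rw [hγ, supp_pairIndicator hab] at hM
  rw [hM.eq_singleton_of_pair hab] at hc
  simpa [cost] using hc

end EdgeMetric

/-! ### The shortest-chain metric -/

section ChainMetric

variable [DecidableEq V] [Fintype E] {ι : E → Sym2 V}

/-- **The shortest-chain metric** of a link-connected graphlike model is a link metric.
[cite: KorteVygen2002, §12.2 proof of Thm 12.9 (the metric closure (Ḡ, c̄))] -/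
noncomputable def chainMetric [DecidableEq E] (ι : E → Sym2 V) (h : IsLinkConnected ι) : EdgeMetric ι where
  d := chainDist ι
  symm := chainDist_comm
  triangle := chainDist_triangle h
  ends_le_one := chainDist_ends_le_one

/-- `(chainMetric ι h).d = chainDist ι`. [cite: KorteVygen2002, §12.2 proof of Thm 12.9 (metric closure)] -/
@[simp] theorem chainMetric_d [DecidableEq E] (h : IsLinkConnected ι) : (chainMetric ι h).d = chainDist ι := rfl

/-- Any link metric is dominated by the shortest-chain metric on pairs joined by a chain (so the geodesic
requirement `|γ| ≤ d a b` of a matching decoder forces `d = chainDist` on the matched pairs). [cite: KorteVygen2002, §12.2 proof of Thm 12.9 (c̄ ≤ c along any path)] -/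
theorem EdgeMetric.d_le_chainDist [Fintype V] [DecidableEq E] (m : EdgeMetric ι) (h : IsLinkConnected ι) {a b : V} (hab : a ≠ b) :
    m.d a b ≤ chainDist ι a b := by
  obtain ⟨γ, hγ, hn⟩ := exists_chain_of_isLinkConnected h a b
  rw [← hn]
  exact m.d_le_hammingNorm hab hγ

end ChainMetric

end Literature.InformationTheory.QuantumCodes
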